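import Summits.MatrixMultiplication.MatrixMultiplication.Theorems.AbelianSTPPCensusTAStatKMember

/-!
# Static t*-certificate: soundness of the k-member bucket-descent tree

Cell mm-stpp (rung F-M1); checkers in `AbelianSTPPCensusTAStatKMember.lean`.  The tree is sound for a shape list once its ROW FACTS hold
(`TAStatKM.Hyps`: every member other than the maximal member `l` with `t ≤ TB[j+1] − 1` is dominated by the row entry `j` — vM fraction and U11-G
fraction at `TB[j]` —; the companions' caps U11 / U14 / E3 at `l`; the Grynkiewicz budget at every parameter `t ≥ 3` that has a source member
(`smallest size < t ≤` its least pair product); completeness of the bucket lists `M2`; `TB` monotone): then `rootK … = true` at the bucket of `t*`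
gives `Σ_q gain_q ≤ 10⁶·M` (`rootK_sound`).  The proof is an induction over the fuel with an explicit index set `S ∋ l` (`NodeInv`: the aggregates
are the sums over `S ∖ l`, every explicit companion has `t ≥ TB[j]`, every other member has `t ≤ TB[j+1] − 1` and, if in bucket `j`, its sorted
shape lies in the allowed list); case (i)/(ii) of a node is the classical dichotomy «some non-explicit member lies in bucket `j`» (its sorted shape
occurs in the allowed list; the earliest occurrence is the child used) / «none does» (descent).  Exact integer twin: seat calc/twomember/tastat7.py.
WHAT THIS IS NOT: no statement about STPP families, orders or `ω` — the arithmetic meaning of a Bool tree over shape data.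
-/

set_option linter.dupNamespace false
set_option autoImplicit false

namespace Summit.MatrixMultiplication.MatrixMultiplication.Theorems.TAStatKM

open TECert (vol us)
open TAStat (Entry e0)
open ShapeCert (D)

section Sound

variable {N : ℕ} (l : Fin N) (gq pq Vq mn tq : Fin N → ℕ) (ysh : Fin N → ℕ × ℕ × ℕ)
variable (tb : ℕ → ℕ) (m2 : ℕ → List (ℕ × ℕ × ℕ)) (gain : ℕ → ℕ) (row : ℕ → Entry)
variable (g p V d al tl M jtop : ℕ)

/-- The row facts under which the tree is sound (all supplied by a range's `sum_gain_le` at the bucket `jtop` of `t*`): `ysh q` is the sorted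
form of member `q` (volume `Vq`, pair-product sum `pq`, smallest size `mn`, least pair product `tq`, gain `gq = gain ∘ Vq`); `l` carries
`(g, p, V, al, tl)` and has maximal volume; every `q ≠ l` with `tq q ≤ TB[j+1] − 1`, `j ≤ jtop`, is dominated by `row j` (vM; U11-G at `TB[j]`);
denominators positive; `TB` monotone; the lists `M2[j]` are complete; the companions' caps (U11 with `l`'s excess `d`, U14 and E3 at `l`); the
Grynkiewicz budget at every `t ≥ 3` with a source member; and some member other than `l` exists. [bookkeeping] -/
structure Hyps : Prop where
  ysh_vol : ∀ q, vol (ysh q) = Vq q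
  ysh_us : ∀ q, us (ysh q) = pq q
  ysh_a : ∀ q, (ysh q).1 = mn q
  ysh_t : ∀ q, (ysh q).1 * (ysh q).2.1 = tq q
  gain_eq : ∀ q, gain (Vq q) = gq q
  gl : gq l = g
  pl : pq l = p
  Vl : Vq l = V
  al_eq : mn l = al
  tl_eq : tq l = tl
  Vle : ∀ q, Vq q ≤ V
  Vgen : ∀ q t, mn q ≤ t → Vq q ≤ t * pq q
  ppos : ∀ q, 1 ≤ pq q
  domP : ∀ j ≤ jtop, ∀ q, q ≠ l → tq q ≤ tb (j + 1) - 1 → gq q * (row j).2.1 ≤ (row j).1 * pq q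
  domW : ∀ j ≤ jtop, ∀ q, q ≠ l → tq q ≤ tb (j + 1) - 1 →
    Vq q < tb j * pq q ∧ gq q * (row j).2.2.2 ≤ (row j).2.2.1 * (tb j * pq q - Vq q)
  den : ∀ j ≤ jtop, 1 ≤ (row j).2.1 ∧ 1 ≤ (row j).2.2.2
  tbmono : ∀ j, tb j ≤ tb (j + 1)
  tbsmall : ∀ j, tb j < 1000000
  complete : ∀ q, q ≠ l → ∀ j ≤ jtop, tb j ≤ tq q → tq q ≤ tb (j + 1) - 1 → ysh q ∈ m2 j
  sum1 : 2 * (∑ q ∈ Finset.univ.erase l, pq q) + d ≤ 3 * M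
  sum2 : (∑ q ∈ Finset.univ.erase l, pq q) + 3 * V ≤ 3 * M
  cap : M < 2 * V → ∑ q ∈ Finset.univ.erase l, pq q ≤ (V * V / M + 3 * M) - 4 * V
  bud : ∀ t, 3 ≤ t → (∃ q, mn q < t ∧ t ≤ tq q) →
    t * ((∑ q ∈ Finset.univ.erase l, pq q) + p) + 1 ≤ ((∑ q ∈ Finset.univ.erase l, Vq q) + V) + t * M + 2 * t * t
  two : ∃ q, q ≠ l

/-- The node invariant for an explicit index set `S ∋ l` with aggregates `A` at bucket `j ≤ jtop` and allowed list `ms`. [bookkeeping] -/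
structure NodeInv (S : Finset (Fin N)) (A : Agg) (j : ℕ) (ms : List (ℕ × ℕ × ℕ)) : Prop where
  lmem : l ∈ S
  hj : j ≤ jtop
  gO : A.1 = ∑ q ∈ S.erase l, gq q
  pO : A.2.1 = ∑ q ∈ S.erase l, pq q
  vO : A.2.2.1 = ∑ q ∈ S.erase l, Vq q
  amin : ∀ t, t < 1000000 → A.2.2.2.1 < t → ∃ q ∈ S.erase l, mn q < t
  amax : ∀ q ∈ S.erase l, mn q ≤ A.2.2.2.2.1
  tmin : ∀ q ∈ S.erase l, tb j ≤ tq q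
  out : ∀ q, q ∉ S → tq q ≤ tb (j + 1) - 1
  allowed : ∀ q, q ∉ S → tb j ≤ tq q → ysh q ∈ ms

variable {l gq pq Vq mn tq ysh tb m2 gain row g p V d al tl M jtop}

/-- splitting a sum over the members other than `l` into the explicit companions and the rest [bookkeeping] -/
theorem sum_split {S : Finset (Fin N)} (hl : l ∈ S) (f : Fin N → ℕ) :
    ∑ q ∈ Finset.univ.erase l, f q = (∑ q ∈ S.erase l, f q) + ∑ q ∈ Finset.univ \ S, f q := by
  classical
  have hdisj : Disjoint (S.erase l) (Finset.univ \ S) := by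
    rw [Finset.disjoint_left]
    intro q hq hq'
    rw [Finset.mem_sdiff] at hq'
    exact hq'.2 (Finset.mem_of_mem_erase hq)
  have hunion : Finset.univ.erase l = (S.erase l) ∪ (Finset.univ \ S) := by
    ext q
    simp only [Finset.mem_erase, Finset.mem_univ, and_true, Finset.mem_union, Finset.mem_sdiff, true_and]
    constructor
    · intro hq
      by_cases h : q ∈ S
      · exact Or.inl ⟨hq, h⟩
      · exact Or.inr h
    · rintro (⟨hq, -⟩ | hq)
      · exact hq
      · intro h; exact hq (h ▸ hl)
  rw [hunion, Finset.sum_union hdisj]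

/-- **A passing node test closes the estimate.**  [original] -/
theorem node_close (H : Hyps l gq pq Vq mn tq ysh tb m2 gain row g p V d al tl M jtop)
    {S : Finset (Fin N)} {A : Agg} {j : ℕ} {ms : List (ℕ × ℕ × ℕ)} (I : NodeInv l gq pq Vq mn tq ysh tb jtop S A j ms) {root : Bool}
    (hroot : root = true → 3 ≤ tb j → ∃ q, mn q < tb j ∧ tb j ≤ tq q)
    (ht : testK g p V d al tl A (tb j) (tb j) M (row j) root = true) :
    g + ∑ q ∈ Finset.univ.erase l, gq q ≤ D * M := by
  classical
  have hout : ∀ q ∈ Finset.univ \ S, q ≠ l ∧ tq q ≤ tb (j + 1) - 1 := by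
    intro q hq
    rw [Finset.mem_sdiff] at hq
    exact ⟨fun h => hq.2 (h ▸ I.lmem), I.out q hq.2⟩
  have hGP : (∑ q ∈ Finset.univ \ S, gq q) * (row j).2.1 ≤ (row j).1 * ∑ q ∈ Finset.univ \ S, pq q := by
    rw [Finset.sum_mul, Finset.mul_sum]
    exact Finset.sum_le_sum fun q hq => H.domP j I.hj q (hout q hq).1 (hout q hq).2
  have hGW : (∑ q ∈ Finset.univ \ S, gq q) * (row j).2.2.2 ≤ (row j).2.2.1 * ∑ q ∈ Finset.univ \ S, (tb j * pq q - Vq q) := by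
    rw [Finset.sum_mul, Finset.mul_sum]
    exact Finset.sum_le_sum fun q hq => (H.domW j I.hj q (hout q hq).1 (hout q hq).2).2
  have sp := sum_split (l := l) I.lmem pq
  have sg := sum_split (l := l) I.lmem gq
  have hpos : 1 ≤ A.2.1 + ∑ q ∈ Finset.univ \ S, pq q := by
    obtain ⟨q, hq⟩ := H.two
    have hmem : q ∈ Finset.univ.erase l := Finset.mem_erase.mpr ⟨hq, Finset.mem_univ q⟩
    have h1 : pq q ≤ ∑ q ∈ Finset.univ.erase l, pq q := Finset.single_le_sum (fun q _ => Nat.zero_le _) hmem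
    have := H.ppos q
    rw [I.pO]; omega
  have key := testK_sound ht (GR := ∑ q ∈ Finset.univ \ S, gq q) (R := ∑ q ∈ Finset.univ \ S, pq q) (W := ∑ q ∈ Finset.univ \ S, (tb j * pq q - Vq q))
    (H.den j I.hj).1 (H.den j I.hj).2 hpos hGP hGW (by rw [I.pO, ← sp]; exact H.sum1) (by rw [I.pO, ← sp]; exact H.sum2)
    (fun h2 => by rw [I.pO, ← sp]; exact H.cap h2) ?_
  · rw [sg, ← I.gO]; omega
  · -- the Grynkiewicz budget at t = tb j from a source, all weights genuine
    intro ht3 hVtp hamax hsrc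
    set t := tb j with htt
    have hsource : ∃ q, mn q < t ∧ t ≤ tq q := by
      rcases hsrc with hr | hm | ⟨htl, hal⟩
      · exact hroot hr ht3
      · obtain ⟨q, hq, hlt⟩ := I.amin t (H.tbsmall j) hm
        exact ⟨q, hlt, I.tmin q hq⟩
      · exact ⟨l, by rw [H.al_eq]; exact hal, by rw [H.tl_eq]; exact htl⟩
    have hbud := H.bud t ht3 hsource
    -- genuineness of every weight other than l's
    have hgen : ∀ q ∈ Finset.univ.erase l, Vq q ≤ t * pq q := by
      intro q hq
      by_cases hS : q ∈ S
      · exact H.Vgen q t ((I.amax q (Finset.mem_erase.mpr ⟨(Finset.mem_erase.mp hq).1, hS⟩)).trans hamax)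
      · exact (H.domW j I.hj q (Finset.mem_erase.mp hq).1 (I.out q hS)).1.le
    have eW : (∑ q ∈ Finset.univ.erase l, (t * pq q - Vq q)) + ∑ q ∈ Finset.univ.erase l, Vq q =
        t * ∑ q ∈ Finset.univ.erase l, pq q := by
      rw [Finset.mul_sum, ← Finset.sum_add_distrib]
      exact Finset.sum_congr rfl fun q hq => Nat.sub_add_cancel (hgen q hq)
    have eS : (∑ q ∈ S.erase l, (t * pq q - Vq q)) + ∑ q ∈ S.erase l, Vq q = t * ∑ q ∈ S.erase l, pq q := by
      rw [Finset.mul_sum, ← Finset.sum_add_distrib]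
      exact Finset.sum_congr rfl fun q hq =>
        Nat.sub_add_cancel (hgen q (Finset.mem_erase.mpr ⟨(Finset.mem_erase.mp hq).1, Finset.mem_univ q⟩))
    have sw := sum_split (l := l) I.lmem (fun q => t * pq q - Vq q)
    have sv := sum_split (l := l) I.lmem Vq
    rw [I.pO, I.vO]
    generalize hA1 : ∑ q ∈ Finset.univ.erase l, (t * pq q - Vq q) = A1 at eW sw
    generalize hA2 : ∑ q ∈ S.erase l, (t * pq q - Vq q) = A2 at eS sw
    generalize hA3 : ∑ q ∈ Finset.univ \ S, (t * pq q - Vq q) = A3 at sw ⊢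
    generalize hP1 : ∑ q ∈ Finset.univ.erase l, pq q = P1 at eW hbud sp
    generalize hP2 : ∑ q ∈ S.erase l, pq q = P2 at eS sp
    generalize hV1 : ∑ q ∈ Finset.univ.erase l, Vq q = V1 at eW hbud sv
    generalize hV2 : ∑ q ∈ S.erase l, Vq q = V2 at eS sv
    have e1 : t * (P1 + p) = t * P1 + t * p := by ring
    rw [e1] at hbud
    have e2 : t * P2 - V2 = A2 := by omega
    rw [e2]
    omega

/-- one unfolding step of the tree [bookkeeping] -/
theorem treeK_succ (kmax n : ℕ) (A : Agg) (j : ℕ) (ms : List (ℕ × ℕ × ℕ)) :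
    treeK tb m2 gain row g p V d al tl M kmax (n + 1) A j ms =
      (testK g p V d al tl A (tb j) (tb j) M (row j) false ||
        ((Nat.blt A.2.2.2.2.2 kmax && goI gain V (fun A' ms' => treeK tb m2 gain row g p V d al tl M kmax n A' j ms') A ms) &&
          match j with
          | 0 => false
          | j' + 1 => treeK tb m2 gain row g p V d al tl M kmax n A j' (m2 j'))) := rfl

/-- **Case (i) of a node.**  If some non-explicit member lies in bucket `j` and every such member has its sorted shape in the list `ms'`, then
`goI` over `ms'` (children = the tree with fuel `n`, assumed sound) closes the estimate: walk the list to the earliest shape carried by such a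
member and make that member explicit. [original] -/
theorem goI_sound (H : Hyps l gq pq Vq mn tq ysh tb m2 gain row g p V d al tl M jtop) {kmax n : ℕ}
    (IH : ∀ (S : Finset (Fin N)) (A : Agg) (j : ℕ) (ms : List (ℕ × ℕ × ℕ)), NodeInv l gq pq Vq mn tq ysh tb jtop S A j ms →
      treeK tb m2 gain row g p V d al tl M kmax n A j ms = true → g + ∑ q ∈ Finset.univ.erase l, gq q ≤ D * M)
    {S : Finset (Fin N)} {A : Agg} {j : ℕ} {ms₀ : List (ℕ × ℕ × ℕ)} (I : NodeInv l gq pq Vq mn tq ysh tb jtop S A j ms₀)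
    (hex : ∃ q, q ∉ S ∧ tb j ≤ tq q) :
    ∀ (ms' : List (ℕ × ℕ × ℕ)), (∀ q, q ∉ S → tb j ≤ tq q → ysh q ∈ ms') →
      goI gain V (fun A' ms'' => treeK tb m2 gain row g p V d al tl M kmax n A' j ms'') A ms' = true →
      g + ∑ q ∈ Finset.univ.erase l, gq q ≤ D * M := by
  classical
  intro ms'
  induction ms' with
  | nil =>
    intro hall _
    obtain ⟨q, hq, hqt⟩ := hex
    exact absurd (hall q hq hqt) (by simp)
  | cons m rest ih =>
    intro hall hg
    have hunf' : goI gain V (fun A' ms'' => treeK tb m2 gain row g p V d al tl M kmax n A' j ms'') A (m :: rest) =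
        ((Nat.blt V (vol m) || treeK tb m2 gain row g p V d al tl M kmax n (addM (gain (vol m)) A m) j (m :: rest)) &&
          goI gain V (fun A' ms'' => treeK tb m2 gain row g p V d al tl M kmax n A' j ms'') A rest) := rfl
    rw [hunf', Bool.and_eq_true, Bool.or_eq_true, Nat.blt_eq] at hg
    obtain ⟨hfirst, hrest⟩ := hg
    by_cases hm : ∃ q, q ∉ S ∧ tb j ≤ tq q ∧ ysh q = m
    · obtain ⟨q₀, hq₀S, hq₀t, hq₀m⟩ := hm
      have hq₀l : q₀ ≠ l := fun h => hq₀S (h ▸ I.lmem)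
      rcases hfirst with hbig | hchild
      · exfalso
        have := H.Vle q₀
        rw [← H.ysh_vol q₀, hq₀m] at this
        omega
      have hSe : (insert q₀ S).erase l = insert q₀ (S.erase l) := by
        rw [Finset.erase_insert_of_ne hq₀l]
      have hq₀e : q₀ ∉ S.erase l := fun h => hq₀S (Finset.mem_of_mem_erase h)
      refine IH (insert q₀ S) (addM (gain (vol m)) A m) j (m :: rest) ⟨?_, I.hj, ?_, ?_, ?_, ?_, ?_, ?_, ?_, ?_⟩ hchild
      · exact Finset.mem_insert_of_mem I.lmem
      · simp only [addM]; rw [hSe, Finset.sum_insert hq₀e, I.gO, ← hq₀m, H.ysh_vol, H.gain_eq, Nat.add_comm]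
      · simp only [addM]; rw [hSe, Finset.sum_insert hq₀e, I.pO, ← hq₀m, H.ysh_us, Nat.add_comm]
      · simp only [addM]; rw [hSe, Finset.sum_insert hq₀e, I.vO, ← hq₀m, H.ysh_vol, Nat.add_comm]
      · intro t htb hlt
        simp only [addM] at hlt
        rcases lt_or_ge m.1 t with h1 | h1
        · exact ⟨q₀, by rw [hSe]; exact Finset.mem_insert_self _ _, by rw [← H.ysh_a, hq₀m]; exact h1⟩
        · have hlt' : A.2.2.2.1 < t := by
            by_contra hc; push Not at hc
            exact absurd hlt (not_lt.mpr (le_min hc h1))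
          obtain ⟨q, hq, hq'⟩ := I.amin t htb hlt'
          exact ⟨q, by rw [hSe]; exact Finset.mem_insert_of_mem hq, hq'⟩
      · intro q hq
        rw [hSe, Finset.mem_insert] at hq
        simp only [addM]
        rcases hq with rfl | hq
        · rw [← H.ysh_a, hq₀m]; exact le_max_right _ _
        · exact (I.amax q hq).trans (le_max_left _ _)
      · intro q hq
        rw [hSe, Finset.mem_insert] at hq
        rcases hq with rfl | hq
        · exact hq₀t
        · exact I.tmin q hq
      · intro q hq
        rw [Finset.mem_insert, not_or] at hq
        exact I.out q hq.2
      · intro q hq hqt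
        rw [Finset.mem_insert, not_or] at hq
        exact hall q hq.2 hqt
    · push Not at hm
      refine ih (fun q hq hqt => ?_) hrest
      have hin := hall q hq hqt
      rw [List.mem_cons] at hin
      rcases hin with heq | hin
      · exact absurd heq (hm q hq hqt)
      · exact hin

/-- **Soundness of the tree** (induction over the fuel). [original] -/
theorem treeK_sound (H : Hyps l gq pq Vq mn tq ysh tb m2 gain row g p V d al tl M jtop) (kmax : ℕ) :
    ∀ (n : ℕ) (S : Finset (Fin N)) (A : Agg) (j : ℕ) (ms : List (ℕ × ℕ × ℕ)),
      NodeInv l gq pq Vq mn tq ysh tb jtop S A j ms → treeK tb m2 gain row g p V d al tl M kmax n A j ms = true →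
      g + ∑ q ∈ Finset.univ.erase l, gq q ≤ D * M
  | 0, S, A, j, ms, I, h => by simp [treeK] at h
  | n + 1, S, A, j, ms, I, h => by
    classical
    rw [treeK_succ, Bool.or_eq_true] at h
    rcases h with ht | h
    · exact node_close H I (fun hf => absurd hf Bool.false_ne_true) ht
    rw [Bool.and_eq_true, Bool.and_eq_true] at h
    obtain ⟨⟨-, hgo⟩, hdesc⟩ := h
    by_cases hex : ∃ q, q ∉ S ∧ tb j ≤ tq q
    · exact goI_sound H (treeK_sound H kmax n) I hex ms I.allowed hgo
    · push Not at hex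
      cases j with
      | zero => exact absurd hdesc Bool.false_ne_true
      | succ j' =>
        refine treeK_sound H kmax n S A j' (m2 j') ⟨I.lmem, by have := I.hj; omega, I.gO, I.pO, I.vO, I.amin, I.amax, ?_, ?_, ?_⟩ hdesc
        · intro q hq; exact (H.tbmono j').trans (I.tmin q hq)
        · intro q hq
          have := hex q hq
          omega
        · intro q hq hqt
          have hql : q ≠ l := fun h => hq (h ▸ I.lmem)
          exact H.complete q hql j' (by have := I.hj; omega) hqt (by have := hex q hq; omega)

/-- the root invariant: only `l` explicit [bookkeeping] -/
theorem nodeInv_root {j : ℕ} (hj : j ≤ jtop)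
    (hout : ∀ q, q ≠ l → tq q ≤ tb (j + 1) - 1) (ms : List (ℕ × ℕ × ℕ)) (hall : ∀ q, q ≠ l → tb j ≤ tq q → ysh q ∈ ms) :
    NodeInv l gq pq Vq mn tq ysh tb jtop {l} agg0 j ms := by
  classical
  refine ⟨Finset.mem_singleton_self l, hj, by simp [agg0], by simp [agg0], by simp [agg0], ?_, ?_, ?_, ?_, ?_⟩
  · intro t ht hlt; simp only [agg0] at hlt; omega
  · intro q hq; simp at hq
  · intro q hq; simp at hq
  · intro q hq; exact hout q (by simpa using hq)
  · intro q hq; exact hall q (by simpa using hq)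

/-- **Soundness of the root.**  At the bucket `j ≤ jtop` of `t*` (every member other than `l` has `t ≤ TB[j+1] − 1`; the member realising `t*`
supplies the implicit source; if `j` lies strictly above `l`'s own bucket `j0`, that member is a companion in bucket `j`), a passing `rootK`
gives `g + Σ_{q ≠ l} g_q ≤ 10⁶·M`. [original] -/
theorem rootK_sound (H : Hyps l gq pq Vq mn tq ysh tb m2 gain row g p V d al tl M jtop) {kmax j j0 : ℕ} (hj : j ≤ jtop)
    (hout : ∀ q, q ≠ l → tq q ≤ tb (j + 1) - 1)
    (hroot : 3 ≤ tb j → ∃ q, mn q < tb j ∧ tb j ≤ tq q)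
    (habove : j0 < j → ∃ q, q ≠ l ∧ tb j ≤ tq q)
    (h : rootK tb m2 gain row g p V d al tl M kmax j j0 = true) :
    g + ∑ q ∈ Finset.univ.erase l, gq q ≤ D * M := by
  classical
  have I : NodeInv l gq pq Vq mn tq ysh tb jtop {l} agg0 j (m2 j) :=
    nodeInv_root hj hout (m2 j) (fun q hq hqt => H.complete q hq j hj hqt (hout q hq))
  simp only [rootK, Bool.or_eq_true, Bool.and_eq_true, Nat.blt_eq] at h
  rcases h with ht | ⟨hgo, hdesc⟩
  · exact node_close H I (fun _ h3 => hroot h3) ht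
  by_cases hex : ∃ q, q ∉ ({l} : Finset (Fin N)) ∧ tb j ≤ tq q
  · exact goI_sound H (treeK_sound H kmax (kmax + j + 1)) I hex (m2 j) I.allowed hgo
  · push Not at hex
    have hjj : ¬ j0 < j := by
      intro hlt
      obtain ⟨q, hq, hqt⟩ := habove hlt
      have := hex q (by simpa using hq)
      omega
    rcases hdesc with hlt | hdesc
    · exact absurd hlt hjj
    cases j with
    | zero => exact absurd hdesc Bool.false_ne_true
    | succ j' =>
      refine treeK_sound H kmax (kmax + (j' + 1) + 1) {l} agg0 j' (m2 j') ⟨I.lmem, by omega, I.gO, I.pO, I.vO, I.amin, I.amax, ?_, ?_, ?_⟩ hdesc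
      · intro q hq; simp at hq
      · intro q hq
        have := hex q hq
        omega
      · intro q hq hqt
        have hql : q ≠ l := by simpa using hq
        exact H.complete q hql j' (by omega) hqt (by have := hex q hq; omega)

end Sound


end Summit.MatrixMultiplication.MatrixMultiplication.Theorems.TAStatKM
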